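import Literature.NumberTheory.EllipticCurves.AnticyclotomicBigGaloisRep
import Literature.NumberTheory.GaloisRepresentations.ContinuousRepCoeffExtension
import HarnessLib

/-!
# The big module of a coefficient extension: coordinates
# `(T ⊗_𝒪 𝒪₁) ⊗ Λ_{𝒪₁}^* ≃ (T ⊗ Λ_𝒪^*)^ι` along an `𝒪`-basis of `𝒪₁`

Skinner, Pacific J. Math. 283 (2016) §2.3 (p. 179): for a finite extension of coefficient rings
`𝒪 ⊂ 𝒪₁`, "`T_{f,1} = T_f ⊗_𝒪 𝒪₁` … the Selmer group defined with respect to `T_{f,1}` is canonically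
isomorphic to `Sel(f) ⊗_𝒪 𝒪₁` as a `Λ_{𝒪₁} = Λ_𝒪 ⊗_𝒪 𝒪₁`-module". This file supplies the
MODULE-LEVEL half of that observation in the tree's co-induced model
(`BigRepModule 𝒪 p A` = smooth `p`-primary maps `ℤ_p → A`, file `AnticyclotomicBigGaloisRep.lean`;
`CoeffExtension 𝒪 𝒪₁ A = 𝒪₁ ⊗_𝒪 A`, file `ContinuousRepCoeffExtension.lean`): given an `𝒪`-basis
`b = (b_i)_{i ∈ ι}` of `𝒪₁`,

* §1 `CoeffExtension.coordEquiv b : 𝒪₁ ⊗_𝒪 A ≃ₗ[𝒪] (ι → A)` (coordinates along `b`, Mathlib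
  `TensorProduct.finsuppScalarLeft`), with the action of `c ∈ 𝒪₁` read through the regular-representation
  matrix `(b.repr (c * b j) i)` (`coordEquiv_smul`) and equivariance for `ρ ⊗ 1` (`coordEquiv_extendScalars`);
* §2 `BigRepModule.piEquiv : BigRepModule 𝒪 p (ι → A) ≃ₗ[𝒪⟦T⟧] (ι → BigRepModule 𝒪 p A)`
  (`ι` finite: a map into a finite product is smooth / `p`-primary iff its coordinates are);
* §3 `BigRepModule.restrictScalarsEquiv 𝒪 : BigRepModule 𝒪₁ p C ≃+ BigRepModule 𝒪 p C` (same maps,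
  scalars restricted along `𝒪 → 𝒪₁`), under which `f ∈ 𝒪⟦T⟧ ⊂ 𝒪₁⟦T⟧` acts as `f`
  (`restrictScalarsEquiv_map_smul`, the finite-sum action `LocNil.evalT` on both sides);
* §4 the composite **coordinate system**
  `BigRepModule.coeffCoord b : BigRepModule 𝒪₁ p (𝒪₁ ⊗_𝒪 A) ≃+ (ι → BigRepModule 𝒪 p A)`,
  `(coeffCoord b Φ i)(x) = coord_i (Φ x)`, which is `𝒪⟦T⟧`-linear (`coeffCoord_map_smul`), carries
  `s ∈ 𝒪₁⟦T⟧` to the matrix `(e.repr (s * e j) i)` of any `𝒪⟦T⟧`-basis `e` of `𝒪₁⟦T⟧` with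
  `e j = C (b j)` (`coeffCoord_smul_eq_sum`; such `e` exists by
  `Literature.RingTheory.PowerSeries.exists_basis_eq_C`), and intertwines the big Galois actions
  `bigRep κ (ρ.extendScalars 𝒪₁)` and `bigRep κ ρ` coordinatewise (`coeffCoord_bigRep`).

With `Literature/NumberTheory/GaloisRepresentations/ContinuousH1CoefficientTransport.lean` this gives
`H¹(K, M(ρ ⊗ 𝒪₁)) ≃ H¹(K, M(ρ))^ι` compatibly with `𝒪₁⟦T⟧`, the input of the discharge of the named
fact `Skinner2016.selmerBig_extendScalars_equiv_baseChange`. Definitions with bodies and proved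
lemmas only; no named fact, no `sorry`, no instance, no notation.

References: [Skinner2016PacificMC] §2.3 (p. 179); [SkinnerUrban2014] §3.1.3 (`Λ^* = lim Maps(Γ/Γ^{pⁿ}, ·)`);
[Castella2018Erratum] §2 p. 4 ("after possibly enlarging `𝒪`").
-/

noncomputable section

open scoped TensorProduct
open PowerSeries Literature.NumberTheory.GaloisRepresentations

namespace Literature.NumberTheory.EllipticCurves

/-! ### §0. Two coordinate identities for a basis of an algebra -/

section BasisAlgebra

variable {R : Type*} [CommRing R] {S : Type*} [CommRing S] [Algebra R S] {ι : Type*} [Fintype ι]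

/-- Coordinates of a product along a basis `b` of an `R`-algebra `S`:
`b.repr (x * y) i = ∑_k b.repr x k * b.repr (b k * y) i` (expand `x`). [folklore] -/
private theorem basis_repr_mul_eq_sum (b : Module.Basis ι R S) (x y : S) (i : ι) :
    b.repr (x * y) i = ∑ k, b.repr x k * b.repr (b k * y) i := by
  conv_lhs => rw [← b.sum_repr x, Finset.sum_mul]
  rw [map_sum, Finset.sum_apply']
  refine Finset.sum_congr rfl fun k _ ↦ ?_
  rw [smul_mul_assoc, map_smul, Finsupp.smul_apply, smul_eq_mul]

end BasisAlgebra

/-! ### §1. Coordinates on `𝒪₁ ⊗_𝒪 A` along an `𝒪`-basis of `𝒪₁` -/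

namespace CoeffExtension

variable {𝒪 : Type*} [CommRing 𝒪] {𝒪₁ : Type*} [CommRing 𝒪₁] [Algebra 𝒪 𝒪₁]
  {A : Type*} [AddCommGroup A] [Module 𝒪 A] {ι : Type*} [Finite ι] [DecidableEq ι]
  (b : Module.Basis ι 𝒪 𝒪₁)

/-- **Coordinates of `𝒪₁ ⊗_𝒪 A` along an `𝒪`-basis `b` of `𝒪₁`**: `c ⊗ a ↦ (b.repr c i • a)_i`, an
`𝒪`-linear isomorphism `𝒪₁ ⊗_𝒪 A ≃ A^ι` (Mathlib `TensorProduct.finsuppScalarLeft`).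
[cite: Skinner2016PacificMC, §2.3 (p. 179, "T_{f,1} = T_f ⊗_𝒪 𝒪₁")] -/
def coordEquiv : CoeffExtension 𝒪 𝒪₁ A ≃ₗ[𝒪] (ι → A) :=
  ((TensorProduct.congr b.repr (LinearEquiv.refl 𝒪 A)).trans
    (TensorProduct.finsuppScalarLeft 𝒪 A ι)).trans (Finsupp.linearEquivFunOnFinite 𝒪 A ι)

/-- Coordinates of a pure tensor: `coord (c ⊗ a) i = b.repr c i • a`. [cite: Skinner2016PacificMC, §2.3 (p. 179)] -/
@[simp] theorem coordEquiv_tmul (c : 𝒪₁) (a : A) (i : ι) :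
    coordEquiv b (CoeffExtension.tmul c a : CoeffExtension 𝒪 𝒪₁ A) i = b.repr c i • a := by
  change Finsupp.linearEquivFunOnFinite 𝒪 A ι
    (TensorProduct.finsuppScalarLeft 𝒪 A ι (b.repr c ⊗ₜ[𝒪] a)) i = _
  rw [Finsupp.linearEquivFunOnFinite_apply, TensorProduct.finsuppScalarLeft_apply_tmul_apply]

/-- **The `𝒪₁`-action in coordinates is the regular-representation matrix of `b`**:
`coord (c • x) i = ∑_j b.repr (c * b j) i • coord x j`. [cite: Skinner2016PacificMC, §2.3 (p. 179, "as a Λ_{𝒪₁} = Λ_𝒪 ⊗_𝒪 𝒪₁-module")] -/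
theorem coordEquiv_smul [Fintype ι] (c : 𝒪₁) (x : CoeffExtension 𝒪 𝒪₁ A) (i : ι) :
    coordEquiv b (c • x) i = ∑ j, b.repr (c * b j) i • coordEquiv b x j := by
  induction x using CoeffExtension.induction_on with
  | zero => simp only [smul_zero, map_zero, Pi.zero_apply, Finset.sum_const_zero]
  | tmul c' a =>
    have h : c • (CoeffExtension.tmul c' a : CoeffExtension 𝒪 𝒪₁ A) = CoeffExtension.tmul (c * c') a :=
      rfl
    rw [h, coordEquiv_tmul]
    simp only [coordEquiv_tmul, smul_smul, ← Finset.sum_smul]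
    congr 1
    rw [mul_comm c c', basis_repr_mul_eq_sum b c' c i]
    exact Finset.sum_congr rfl fun k _ ↦ by rw [mul_comm (b k) c, mul_comm]
  | add x y hx hy =>
    simp only [smul_add, map_add, Pi.add_apply, hx, hy, ← Finset.sum_add_distrib]

/-- The inverse coordinate map: `(a_i)_i ↦ ∑_i b_i ⊗ a_i`. [cite: Skinner2016PacificMC, §2.3 (p. 179)] -/
theorem coordEquiv_symm_apply [Fintype ι] (v : ι → A) :
    (coordEquiv b).symm v = ∑ i, (CoeffExtension.tmul (b i) (v i) : CoeffExtension 𝒪 𝒪₁ A) := by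
  apply (coordEquiv (A := A) b).injective
  rw [LinearEquiv.apply_symm_apply, map_sum]
  funext j
  rw [Finset.sum_apply, Finset.sum_eq_single j]
  · rw [coordEquiv_tmul, b.repr_self_apply, if_pos rfl, one_smul]
  · intro i _ hij
    rw [coordEquiv_tmul, b.repr_self_apply, if_neg hij, zero_smul]
  · intro h
    exact absurd (Finset.mem_univ j) h

variable [TopologicalSpace 𝒪] [TopologicalSpace 𝒪₁] [TopologicalSpace A] [DiscreteTopology A]
  {G : Type*} [Group G] [TopologicalSpace G] [ContinuousMul G]

/-- **Coordinates are `G`-equivariant for `ρ ⊗ 1`**: `coord ((ρ g ⊗ 1) x) i = ρ g (coord x i)`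
(`ρ g` is `𝒪`-linear). [cite: Skinner2016PacificMC, §2.3 (p. 179, "T_{f,1} = T_f ⊗_𝒪 𝒪₁ is a G_ℚ-stable 𝒪₁-lattice")] -/
theorem coordEquiv_extendScalars (ρ : ContinuousRep G 𝒪 A) (g : G) (x : CoeffExtension 𝒪 𝒪₁ A)
    (i : ι) : coordEquiv b (ρ.extendScalars 𝒪₁ g x) i = ρ g (coordEquiv b x i) := by
  induction x using CoeffExtension.induction_on with
  | zero => rw [map_zero, map_zero, Pi.zero_apply, map_zero]
  | tmul c a => rw [ContinuousRep.extendScalars_apply_tmul, coordEquiv_tmul, coordEquiv_tmul, map_smul]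
  | add x y hx hy => simp only [map_add, Pi.add_apply, hx, hy]

end CoeffExtension

/-! ### §2. `BigRepModule 𝒪 p (ι → A) ≃ (ι → BigRepModule 𝒪 p A)` for finite `ι` -/

namespace BigRepModule

section Pi

variable {𝒪 : Type*} [CommRing 𝒪] {p : ℕ} [Fact p.Prime] {A : Type*} [AddCommGroup A] [Module 𝒪 A]
  {ι : Type*}

/-- A function of level `n` has every level `m ≥ n` (local copy of the private
`IsSmoothOfLevel.mono`). [cite: SkinnerUrban2014, §3.1.3 (Λ^* = lim Maps(Γ/Γ^{pⁿ}, ·))] -/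
theorem isSmoothOfLevel_mono {B : Type*} {n m : ℕ} (hnm : n ≤ m) {Φ : ℤ_[p] → B}
    (hΦ : IsSmoothOfLevel p B n Φ) : IsSmoothOfLevel p B m Φ := fun x y hxy ↦
  hΦ x y (Ideal.span_singleton_le_span_singleton.mpr (pow_dvd_pow _ hnm) hxy)

/-- The tuple of coordinate functions of a smooth `p`-primary `Φ : ℤ_p → A^ι`, as an `𝒪⟦T⟧`-linear map
(coordinatewise `mapRangeₗ` along the projections). [cite: SkinnerUrban2014, §3.1.3 (Maps(Γ/Γ^{pⁿ}, ·) is additive in the coefficients)] -/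
def toPi : BigRepModule 𝒪 p (ι → A) →ₗ[PowerSeries 𝒪] (ι → BigRepModule 𝒪 p A) :=
  LinearMap.pi fun i ↦ mapRangeₗ (LinearMap.proj i)

/-- Unfolding `toPi`: `(toPi Φ i) x = Φ x i`. [cite: SkinnerUrban2014, §3.1.3] -/
@[simp] theorem toPi_apply (Φ : BigRepModule 𝒪 p (ι → A)) (i : ι) (x : ℤ_[p]) :
    toPi Φ i x = Φ x i := rfl

/-- Assembling a smooth `p`-primary map into `A^ι` from its (finitely many) coordinates: the level is
the maximum of the levels, the exponent the maximum of the exponents. [cite: SkinnerUrban2014, §3.1.3] -/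
theorem pi_mem_bigRepSubmodule [Fintype ι] (Ψ : ι → BigRepModule 𝒪 p A) :
    (fun x i ↦ Ψ i x) ∈ bigRepSubmodule 𝒪 p (ι → A) := by
  choose n hn using fun i ↦ (Ψ i).exists_level
  choose k hk using fun i ↦ (Ψ i).exists_torsion
  refine ⟨⟨Finset.univ.sup n, fun x y hxy ↦ funext fun i ↦ ?_⟩,
    ⟨Finset.univ.sup k, fun x ↦ funext fun i ↦ ?_⟩⟩
  · exact isSmoothOfLevel_mono (Finset.le_sup (Finset.mem_univ i)) (hn i) x y hxy
  · rw [Pi.smul_apply, Pi.zero_apply, ← Nat.sub_add_cancel (Finset.le_sup (f := k) (Finset.mem_univ i)),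
      pow_add, mul_smul, hk i, smul_zero]

/-- **`BigRepModule 𝒪 p (ι → A) ≃ (ι → BigRepModule 𝒪 p A)`** (`𝒪⟦T⟧`-linearly) for finite `ι`:
a map `ℤ_p → A^ι` is smooth and `p`-primary iff its coordinates are.
[cite: SkinnerUrban2014, §3.1.3 (Λ^* = lim Maps(Γ/Γ^{pⁿ}, ·); T ⊗ Λ^* additive in T)] -/
def piEquiv [Fintype ι] : BigRepModule 𝒪 p (ι → A) ≃ₗ[PowerSeries 𝒪] (ι → BigRepModule 𝒪 p A) where
  toLinearMap := toPi
  invFun Ψ := mk (fun x i ↦ Ψ i x) (pi_mem_bigRepSubmodule Ψ)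
  left_inv Φ := by ext; rfl
  right_inv Ψ := by funext i; ext; rfl

/-- Unfolding `piEquiv`. [cite: SkinnerUrban2014, §3.1.3] -/
@[simp] theorem piEquiv_apply [Fintype ι] (Φ : BigRepModule 𝒪 p (ι → A)) (i : ι) (x : ℤ_[p]) :
    piEquiv Φ i x = Φ x i := rfl

/-- Unfolding `piEquiv.symm`. [cite: SkinnerUrban2014, §3.1.3] -/
@[simp] theorem piEquiv_symm_apply [Fintype ι] (Ψ : ι → BigRepModule 𝒪 p A) (x : ℤ_[p]) (i : ι) :
    (piEquiv (𝒪 := 𝒪)).symm Ψ x i = Ψ i x := rfl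

/-- Finite sums in `BigRepModule` are pointwise. [cite: SkinnerUrban2014, §3.1.3] -/
theorem finset_sum_apply {β : Type*} (s : Finset β) (Φ : β → BigRepModule 𝒪 p A) (x : ℤ_[p]) :
    (∑ j ∈ s, Φ j) x = ∑ j ∈ s, Φ j x := by
  classical
  induction s using Finset.induction_on with
  | empty => rw [Finset.sum_empty, Finset.sum_empty, zero_apply]
  | insert j s hj ih => rw [Finset.sum_insert hj, Finset.sum_insert hj, add_apply, ih]

end Pi

/-! ### §3. Restricting the scalars of the big module along `𝒪 → 𝒪₁` -/

section Restrict

variable (𝒪 : Type*) [CommRing 𝒪] {𝒪₁ : Type*} [CommRing 𝒪₁] {p : ℕ} [Fact p.Prime]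
  {C : Type*} [AddCommGroup C] [Module 𝒪 C] [Module 𝒪₁ C]

/-- **The same smooth `p`-primary maps `ℤ_p → C`, with scalars `𝒪₁` forgotten to `𝒪`** (the carrier
condition — smooth, `p`-power torsion — does not mention the scalars).
[cite: Skinner2016PacificMC, §2.3 (p. 179, "Λ_{𝒪₁} = Λ_𝒪 ⊗_𝒪 𝒪₁-module")] -/
def restrictScalarsEquiv : BigRepModule 𝒪₁ p C ≃+ BigRepModule 𝒪 p C where
  toFun Φ := mk (⇑Φ) ⟨Φ.exists_level, Φ.exists_torsion⟩
  invFun Φ := mk (⇑Φ) ⟨Φ.exists_level, Φ.exists_torsion⟩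
  left_inv Φ := by ext; rfl
  right_inv Φ := by ext; rfl
  map_add' Φ Ψ := by ext; rfl

/-- Unfolding `restrictScalarsEquiv`: it is the identity on maps. [cite: Skinner2016PacificMC, §2.3 (p. 179)] -/
@[simp] theorem restrictScalarsEquiv_apply (Φ : BigRepModule 𝒪₁ p C) (x : ℤ_[p]) :
    restrictScalarsEquiv 𝒪 Φ x = Φ x := rfl

/-- `restrictScalarsEquiv` commutes with `τ₁ - 1` (the action of `T`). [cite: Castella2018, §2.2 (1 + T ↦ γ)] -/
theorem restrictScalarsEquiv_shiftSubOne (Φ : BigRepModule 𝒪₁ p C) :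
    restrictScalarsEquiv 𝒪 (shiftSubOne Φ) = shiftSubOne (restrictScalarsEquiv 𝒪 Φ) := by
  ext; rfl

/-- `restrictScalarsEquiv` commutes with the powers of `τ₁ - 1`. [cite: Castella2018, §2.2 (1 + T ↦ γ)] -/
theorem restrictScalarsEquiv_shiftSubOne_pow (n : ℕ) (Φ : BigRepModule 𝒪₁ p C) :
    restrictScalarsEquiv 𝒪 ((shiftSubOne ^ n) Φ) = (shiftSubOne ^ n) (restrictScalarsEquiv 𝒪 Φ) := by
  induction n generalizing Φ with
  | zero => rfl
  | succ n ih =>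
    rw [pow_succ, pow_succ, Module.End.mul_apply, Module.End.mul_apply, ih,
      restrictScalarsEquiv_shiftSubOne]

variable [Algebra 𝒪 𝒪₁] [IsScalarTower 𝒪 𝒪₁ C]

/-- **`f ∈ 𝒪⟦T⟧ ⊂ 𝒪₁⟦T⟧` acts as `f`**: `restrictScalarsEquiv (f^{𝒪₁} • Φ) = f • restrictScalarsEquiv Φ`,
where `f^{𝒪₁} = PowerSeries.map (algebraMap 𝒪 𝒪₁) f` (both actions are the finite-sum actions
`∑ coeff_i • (τ₁-1)^i` on an element killed by `(τ₁-1)^N`). [cite: Skinner2016PacificMC, §2.3 (p. 179, "as a Λ_{𝒪₁} = Λ_𝒪 ⊗_𝒪 𝒪₁-module")] -/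
theorem restrictScalarsEquiv_map_smul (f : PowerSeries 𝒪) (Φ : BigRepModule 𝒪₁ p C) :
    restrictScalarsEquiv 𝒪 (PowerSeries.map (algebraMap 𝒪 𝒪₁) f • Φ) =
      f • restrictScalarsEquiv 𝒪 Φ := by
  obtain ⟨N, hN⟩ := shiftSubOne_locNil (𝒪 := 𝒪₁) (p := p) (A := C) Φ
  have hN' : (shiftSubOne ^ N) (restrictScalarsEquiv 𝒪 Φ) = 0 := by
    rw [← restrictScalarsEquiv_shiftSubOne_pow, hN, map_zero]
  rw [powerSeries_smul_def, powerSeries_smul_def, LocNil.IsLocNil.smulFun_apply _ _ hN,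
    LocNil.IsLocNil.smulFun_apply _ _ hN', LocNil.evalT, LocNil.evalT, map_sum]
  refine Finset.sum_congr rfl fun i _ ↦ ?_
  rw [PowerSeries.coeff_map, ← restrictScalarsEquiv_shiftSubOne_pow]
  ext x
  rw [restrictScalarsEquiv_apply, smul_apply, smul_apply, restrictScalarsEquiv_apply, algebraMap_smul]

end Restrict

/-! ### §4. The coordinate system of the big module of a coefficient extension -/

section CoeffCoord

variable {𝒪 : Type*} [CommRing 𝒪] {𝒪₁ : Type*} [CommRing 𝒪₁] [Algebra 𝒪 𝒪₁] {p : ℕ} [Fact p.Prime]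
  {A : Type*} [AddCommGroup A] [Module 𝒪 A] {ι : Type*} [Fintype ι] [DecidableEq ι]
  (b : Module.Basis ι 𝒪 𝒪₁)

/-- **Coordinates of the big module of `ρ ⊗ 𝒪₁` along an `𝒪`-basis `b` of `𝒪₁`**:
`BigRepModule 𝒪₁ p (𝒪₁ ⊗_𝒪 A) ≃ (BigRepModule 𝒪 p A)^ι`, `Φ ↦ (coord_i ∘ Φ)_i` — the module-level
content of "`Sel(T ⊗_𝒪 𝒪₁) ≅ Sel(T) ⊗_𝒪 𝒪₁`". [cite: Skinner2016PacificMC, §2.3 (p. 179)] -/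
def coeffCoord : BigRepModule 𝒪₁ p (CoeffExtension 𝒪 𝒪₁ A) ≃+ (ι → BigRepModule 𝒪 p A) :=
  (restrictScalarsEquiv 𝒪).trans
    (((mapRangeEquiv (CoeffExtension.coordEquiv b)).trans piEquiv).toAddEquiv)

/-- Unfolding `coeffCoord`: `(coeffCoord b Φ i) x = coord_i (Φ x)`. [cite: Skinner2016PacificMC, §2.3 (p. 179)] -/
@[simp] theorem coeffCoord_apply (Φ : BigRepModule 𝒪₁ p (CoeffExtension 𝒪 𝒪₁ A)) (i : ι) (x : ℤ_[p]) :
    coeffCoord b Φ i x = CoeffExtension.coordEquiv b (Φ x) i := rfl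

/-- **`𝒪⟦T⟧`-linearity of the coordinates**: `coeffCoord (f^{𝒪₁} • Φ) = f • coeffCoord Φ`.
[cite: Skinner2016PacificMC, §2.3 (p. 179, "as a Λ_{𝒪₁} = Λ_𝒪 ⊗_𝒪 𝒪₁-module")] -/
theorem coeffCoord_map_smul (f : PowerSeries 𝒪) (Φ : BigRepModule 𝒪₁ p (CoeffExtension 𝒪 𝒪₁ A)) :
    coeffCoord b (PowerSeries.map (algebraMap 𝒪 𝒪₁) f • Φ) = f • coeffCoord b Φ := by
  change ((mapRangeEquiv (CoeffExtension.coordEquiv b)).trans piEquiv)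
      (restrictScalarsEquiv 𝒪 (PowerSeries.map (algebraMap 𝒪 𝒪₁) f • Φ)) = _
  rw [restrictScalarsEquiv_map_smul, map_smul]
  rfl

/-- **Constants `c ∈ 𝒪₁` act on coordinates through the regular-representation matrix of `b`**:
`coeffCoord (C c • Φ) i = ∑_j C (b.repr (c * b j) i) • coeffCoord Φ j`.
[cite: Skinner2016PacificMC, §2.3 (p. 179)] -/
theorem coeffCoord_C_smul (c : 𝒪₁) (Φ : BigRepModule 𝒪₁ p (CoeffExtension 𝒪 𝒪₁ A)) (i : ι) :
    coeffCoord b (PowerSeries.C c • Φ) i =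
      ∑ j, PowerSeries.C (b.repr (c * b j) i) • coeffCoord b Φ j := by
  ext x
  rw [coeffCoord_apply, C_smul, smul_apply, CoeffExtension.coordEquiv_smul, finset_sum_apply]
  refine Finset.sum_congr rfl fun j _ ↦ ?_
  rw [C_smul, smul_apply, coeffCoord_apply]

omit [DecidableEq ι] in
/-- Along a basis `e` of `𝒪₁⟦T⟧` over `𝒪⟦T⟧` with `e j = C (b j)`, constants have constant coordinates:
`e.repr (C x) i = C (b.repr x i)`. [folklore] -/
private theorem basis_repr_C (e : Module.Basis ι (PowerSeries 𝒪) (PowerSeries 𝒪₁)) (he : ∀ j, e j = C (b j))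
    (x : 𝒪₁) (i : ι) : e.repr (PowerSeries.C x) i = PowerSeries.C (b.repr x i) := by
  have hx : PowerSeries.C x = ∑ j, PowerSeries.C (b.repr x j) • e j := by
    conv_lhs => rw [← b.sum_repr x]
    rw [map_sum]
    refine Finset.sum_congr rfl fun j _ ↦ ?_
    rw [he, Algebra.smul_def (PowerSeries.C (b.repr x j)), PowerSeries.algebraMap_apply'',
      PowerSeries.map_C, ← map_mul, ← Algebra.smul_def]
  rw [hx, e.repr_sum_self]

/-- **Every `s ∈ 𝒪₁⟦T⟧` acts on coordinates through its regular-representation matrix** along a basis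
`e = (C (b j))_j` of `𝒪₁⟦T⟧` over `𝒪⟦T⟧`: `coeffCoord (s • Φ) i = ∑_j e.repr (s * e j) i • coeffCoord Φ j`
(expand `s = ∑_k s_k C(b_k)` with `s_k ∈ 𝒪⟦T⟧`). This is the `Λ_{𝒪₁} = Λ_𝒪 ⊗_𝒪 𝒪₁`-structure in
coordinates. [cite: Skinner2016PacificMC, §2.3 (p. 179, "as a Λ_{𝒪₁} = Λ_𝒪 ⊗_𝒪 𝒪₁-module")] -/
theorem coeffCoord_smul_eq_sum (e : Module.Basis ι (PowerSeries 𝒪) (PowerSeries 𝒪₁))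
    (he : ∀ j, e j = C (b j)) (s : PowerSeries 𝒪₁)
    (Φ : BigRepModule 𝒪₁ p (CoeffExtension 𝒪 𝒪₁ A)) (i : ι) :
    coeffCoord b (s • Φ) i = ∑ j, e.repr (s * e j) i • coeffCoord b Φ j := by
  -- expand `s` along `e`
  have hs : s = ∑ k, PowerSeries.map (algebraMap 𝒪 𝒪₁) (e.repr s k) * PowerSeries.C (b k) := by
    conv_lhs => rw [← e.sum_repr s]
    refine Finset.sum_congr rfl fun k _ ↦ ?_
    rw [Algebra.smul_def, PowerSeries.algebraMap_apply'', he]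
  have lhs : coeffCoord b (s • Φ) i =
      ∑ k, e.repr s k • ∑ j, PowerSeries.C (b.repr (b k * b j) i) • coeffCoord b Φ j := by
    conv_lhs => rw [hs, Finset.sum_smul, map_sum, Finset.sum_apply]
    refine Finset.sum_congr rfl fun k _ ↦ ?_
    rw [mul_smul, coeffCoord_map_smul, Pi.smul_apply, coeffCoord_C_smul]
  rw [lhs]
  -- compare coefficients of `coeffCoord b Φ j`
  have rhs : ∀ j, e.repr (s * e j) i = ∑ k, e.repr s k * PowerSeries.C (b.repr (b k * b j) i) := by
    intro j
    rw [basis_repr_mul_eq_sum e s (e j) i]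
    refine Finset.sum_congr rfl fun k _ ↦ ?_
    rw [he k, he j, ← map_mul, basis_repr_C b e he]
  simp_rw [rhs, Finset.sum_smul, Finset.smul_sum, smul_smul]
  rw [Finset.sum_comm]

variable [TopologicalSpace 𝒪] [TopologicalSpace 𝒪₁] [TopologicalSpace A] [DiscreteTopology A]
  {G : Type*} [Group G] [TopologicalSpace G] [ContinuousMul G]
  [TopologicalSpace (PowerSeries 𝒪)] [TopologicalSpace (PowerSeries 𝒪₁)]

/-- **The coordinates intertwine the big Galois actions**: for `M₁ = (T ⊗ 𝒪₁) ⊗ Λ_{𝒪₁}^*(Ψ⁻¹)` and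
`M = T ⊗ Λ_𝒪^*(Ψ⁻¹)`, `coeffCoord (g · Φ) i = g · coeffCoord Φ i`
(`(g · Φ)(x) = (ρ g ⊗ 1)(Φ(x - κ g))` coordinatewise). [cite: Skinner2016PacificMC, §2.3 (p. 179, "𝓜 = T_f ⊗_𝒪 Λ_𝒪^* with G_ℚ-action ρ_f ⊗ Ψ⁻¹"; "T_{f,1} is G_ℚ-stable")] -/
theorem coeffCoord_bigRep (κ : G →ₜ* Multiplicative ℤ_[p]) (ρ : ContinuousRep G 𝒪 A) (g : G)
    (Φ : BigRepModule 𝒪₁ p (CoeffExtension 𝒪 𝒪₁ A)) (i : ι) :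
    coeffCoord b (bigRep κ (ρ.extendScalars 𝒪₁) g Φ) i = bigRep κ ρ g (coeffCoord b Φ i) := by
  ext x
  rw [coeffCoord_apply, bigRep_apply_apply, bigRep_apply_apply, coeffCoord_apply,
    CoeffExtension.coordEquiv_extendScalars]

end CoeffCoord

end BigRepModule

end Literature.NumberTheory.EllipticCurves
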